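import Literature.MathematicalPhysics.QuantumFieldTheory.Balaban1983to89.B7Eq214General
import Literature.MathematicalPhysics.QuantumFieldTheory.Balaban1983to89.B7Eq214FlatQprime

/-!
# `Balaban1983to89.B7Eq214GeneralQprime` — T. Bałaban, *Averaging operations for lattice gauge theories*, Commun. Math. Phys.
**98** (1985) 17–51 [Balaban1985Averaging], (212)–(214) p. 50: the bridge between the concrete operator `Q′_j` at a general
background (`B7Eq214General.lamAvgG`) and the tree's decl of record for row B7.Eq212, `B7Eq78Linearization.QprimeIter` (B9 (3.19))
— the operator IS `QprimeIter` on the `ℤᵈ` blocking with the composed transporters (77) of the averaged backgrounds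

statement-level skeleton of published theorems with citation tags; proofs where landed; nothing here is a claim about the Yang–Mills mass gap

PDF held: `paper:balaban1985-cmp98-averaging` (journal page = PDF page + 16); renders `…/1985-cmp98-averaging-p034-x2.png` (p. 50),
`p014-x2.png` (p. 30), read as images by the unit.

CITATION HEADER (lean-in-tree rule).  Cell `lit-balaban` (HOME `run/shared/lean/pub/lit-balaban/`), unit `lit-balaban-r04` (B7
reader/typer, gen 3), companion of `B7Eq214General` (p246213/p246407) — KERNEL PIECE for SKELETON rows `B7.Eq212` (decl of
record `B7Eq78Linearization.QprimeIter`) and `B7.Eq213`; the flat companion is `B7Eq214FlatQprime` (seat p22: `lamAvg_eq_QprimeIter`).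

PRINT (p. 50): "`Q′_j(u₁, λ, y) = Σ_{x∈Bʲ(y)} L^{−jd}R(U₀(Γ^{(j)}_{y,x}))λ(x) + …` (212) hence `Q′_j(u₁, λ, y) = (Q′_jλ)(y) +
C′_j(u₁, λ, y)`, (213) `|C′_j(u₁, λ, y)| = O((α₃α₄ + α₄²)Lʲη)`. (214)"; p. 30 (77)–(78): the composed transports
`R(U₀(Γ^{(j+1)}_{x_{j+1},x})) = R̄ʲ_{0,x_{j+1}}⋯R̄_{0,x₂}R_{0,x₁}` and the one-step average "`(R̄₀v)(y) = … R(V₀(Γ_{y,x}))v(x) …`".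
B9 (3.19) p. 393 [Balaban1985BackgroundPropagators]: the same operator `Q′_j(U)` as a composition of one-step operators.

WHAT THIS FILE PROVES (kernel, no `sorry`, standard axioms).
* `transp L U₀ j z x = Ū₀ʲ(Γ_{Lz,x})` — the transporter of the one step at level `j` (from the site `x` of the block with corner
  `Lz` to the corner, along the tree contour, by the averaged background `Ū₀ʲ = B7Prop2Explicit.avgIter L U₀ j`), the `T` argument
  of `QprimeIter`; `transp_one_left` (trivial at `U₀ = 1`).
* **`lamAvgG_eq_QprimeIter`** — `B7Eq214General.lamAvgG L U₀ j λ z = QprimeIter (zdBlocking d L) (transp L U₀) j λ z` for all `j`,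
  `z`: the concrete `Q′_j` of the @gen kernel IS the tree's `Q′_j` on the `ℤᵈ` blocking (`B7Eq78Linearization.zdBlocking`) with the
  transporters of (77)/(78) (one-step unfolding + `B7Eq214FlatQprime.sum_blockSites_eq_sum_boxVec`; `conjR = cj`).
* **`eq214_general_QprimeIter`** — (213)–(214) at a general background with the decl of record: under the hypotheses of
  `B7Eq214General.eq214_general_of52`, `‖log ũ′ʲ(z) − QprimeIter (zdBlocking d L) (transp L U₀) j λ z‖ ≤ C′_gen(α₃α₄ + α₄²)LʲL^{−k}`.
READINGS: those of `B7Eq214General`; nothing new.  DECLARATIONS: 1 definition (`transp`), 3 theorems.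
Unit `lit-balaban-r04` (gen 3), 2026-08-21.

[cite: Balaban1985Averaging, (212)–(214) p.50, (77)–(78) p.30]
-/

noncomputable section

open NormedSpace Finset

namespace Literature.MathematicalPhysics.QuantumFieldTheory.Balaban1983to89.B7Eq214GeneralQprime

open B7Prop1Explicit B7Prop2Explicit MatrixLog B7Eq92Concrete B7Eq167Flat B7Eq170Flat B7Prop9Flat B7Prop9General B7Prop10General
  B7Eq214Flat B7Eq214General
open B7Eq78Linearization (Qprime Qprime_apply QprimeIter QprimeIter_zero QprimeIter_succ zdBlocking conjR conjR_apply)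
open Literature.MathematicalPhysics.QuantumLattice (blockSites blockBase)
open B7Eq214FlatQprime (sum_blockSites_eq_sum_boxVec)
open B7Prop10Flat (C5)

-- `Site` alone would resolve to the torus sites of `Setup.lean`; re-export the `ℤ^d` sites of `B7Prop1Explicit`.
export B7Prop1Explicit (Site)

variable {d : ℕ}

variable {𝔸 : Type*} [NormedRing 𝔸] [NormOneClass 𝔸] [NormedAlgebra ℂ 𝔸] [CompleteSpace 𝔸]

/-- **The transporters of (212)** at level `j`: `T_j(z, x) = Ū₀ʲ(Γ_{Lz,x})`, the parallel transport of the averaged background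
`Ū₀ʲ` along the tree contour from the block corner `Lz` to the block site `x` — "`(R_{0,y}v)(x) = R(V₀(Γ_{y,x}))v(x)`" (p. 27) at
`V₀ = Ū₀ʲ`, `y = Lz`; composed along the levels these are the `R(U₀(Γ^{(j)}_{y,x}))` of (77)/(212).
[cite: Balaban1985Averaging, (77)–(78) p.30, (212) p.50, p.27 (display after (59))] -/
def transp (L : ℕ) (U₀ : Site d → Fin d → 𝔸ˣ) : ℕ → Site d → Site d → 𝔸ˣ :=
  fun j z x => hol (avgIter L U₀ j) ((L : ℤ) • z) (treeWord (x - (L : ℤ) • z))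

omit [NormOneClass 𝔸] in
/-- `transp_one_left`: at `U₀ = 1` all transporters are trivial (the flat companion's `fun _ _ _ => 1`).
[cite: Balaban1985Averaging, (212) p.50] -/
theorem transp_one_left (L : ℕ) : transp L (1 : Site d → Fin d → 𝔸ˣ) = fun _ _ _ => 1 := by
  funext j z x
  simp [transp, B8Ineq130.hol_one]

omit [NormOneClass 𝔸] in
/-- **The bridge**: the concrete `Q′_j` at a general background (`B7Eq214General.lamAvgG`, the recursion (77)/(80) by the rotated
block means `rlam` at the averaged backgrounds) IS the tree's `Q′_j` of B9 (3.19) / (212) (`B7Eq78Linearization.QprimeIter`, decl of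
record of row B7.Eq212) on the `ℤᵈ` blocking with the transporters `transp L U₀`.  At `U₀ = 1` this is p22's
`B7Eq214FlatQprime.lamAvg_eq_QprimeIter` (`lamAvgG_one_left`, `transp_one_left`). [cite: Balaban1985Averaging, (212)–(213) p.50, (77)–(80) p.30] -/
theorem lamAvgG_eq_QprimeIter (L : ℕ) (U₀ : Site d → Fin d → 𝔸ˣ) (lam : Site d → 𝔸) :
    ∀ (j : ℕ) (z : Site d), lamAvgG L U₀ j lam z = QprimeIter (zdBlocking d L) (transp L U₀) j lam z := by
  intro j
  induction j with
  | zero => intro z; rfl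
  | succ j ih =>
    intro z
    have hB : (zdBlocking d L).B j z = blockSites L z := rfl
    have hwt : ∀ x, (zdBlocking d L).wt j z x = ((L : ℝ) ^ d)⁻¹ := fun _ => rfl
    rw [lamAvgG_succ, rlam_apply, bmean_apply, QprimeIter_succ, Qprime_apply, hB]
    simp only [hwt, conjR_apply, cj_apply, ← ih]
    rw [sum_blockSites_eq_sum_boxVec L z]
    refine Finset.sum_congr rfl fun r _ => ?_
    simp only [transp, add_sub_cancel_left]

variable {L : ℕ} {U₀ : Site d → Fin d → 𝔸ˣ} {k : ℕ} {u' u₁ : Site d → 𝔸ˣ} {α₀ α₃ α₄ : ℝ}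

/-- **(213)–(214) AT A GENERAL BACKGROUND WITH THE DECL OF RECORD `QprimeIter`** — `B7Eq214General.eq214_general_of52` restated through
the bridge: for `U₀` with values in an average-closed `G ⊂ U1` satisfying (52) (`η = L^{−k}`), `u′` with (176)/(177), `u₁ ∈ Λ_k(U₀, α₃)`
and the explicit smallness of `eq214_general_of52`, for all `j ≤ k`, `z`:
`‖log ũ′ʲ(z) − QprimeIter (zdBlocking d L) (transp L U₀) j λ z‖ ≤ C′_gen(α₃α₄ + α₄²)·LʲL^{−k}`, `λ = log u′`, `C′_gen = B7Eq214General.Cgen d`.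
[cite: Balaban1985Averaging, (213)–(214) p.50] -/
theorem eq214_general_QprimeIter (hL : 2 ≤ L) {G : Subgroup 𝔸ˣ} (hG : AvgClosed d L G) (hU : ∀ x κ, U₀ x κ ∈ G)
    (hα : 0 < α₀) (hα3 : C0 d * α₀ ≤ 1 / 3) (hα2 : 2 * α₀ ≤ c2' d L)
    (h52 : pdev U₀ < α₀ * (((L : ℝ) ^ k)⁻¹) ^ 2)
    (h176 : SiteBd u' α₄) (h177 : CovBondBd U₀ u' (α₄ * ((L : ℝ) ^ k)⁻¹))
    (hu₁ : InLambda L U₀ u₁ k α₃ (((L : ℝ) ^ k)⁻¹))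
    (hα₃ : 0 ≤ α₃) (hα₃' : α₃ ≤ 1 / 200) (hα₄ : 0 ≤ α₄)
    (hs₁ : 50 * C6 d * α₄ ≤ 1) (hs₂ : 3000 * ((d : ℝ) + 1) * L * α₄ ≤ 1) (hs₃ : C4G d L * (α₀ + α₃ + α₄) ≤ 1)
    (hs₄ : 1024 * ((d : ℝ) + 1) * ((d : ℝ) + 4) * L ^ 2 * α₀ ≤ 1) (hs₅ : 32 * ((d : ℝ) + 1) ^ 2 * C6 d * L ^ 2 * α₀ ≤ 1)
    (hs₆ : 16 * d * C5' d * C6 d * (L : ℝ) ^ 2 * α₀ ≤ 1) (hs₇ : 8 * d * C6 d * L * α₀ ≤ 1) :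
    ∀ j ≤ k, ∀ z : Site d,
      ‖mlog ((utilG L U₀ u' u₁ j z : 𝔸ˣ) : 𝔸)
          - QprimeIter (zdBlocking d L) (transp L U₀) j (fun x => mlog ((u' x : 𝔸ˣ) : 𝔸)) z‖
        ≤ Cgen d * (α₃ * α₄ + α₄ ^ 2) * ((L : ℝ) ^ j * ((L : ℝ) ^ k)⁻¹) := by
  intro j hj z
  rw [← lamAvgG_eq_QprimeIter]
  exact eq214_general_of52 hL hG hU hα hα3 hα2 h52 h176 h177 hu₁ hα₃ hα₃' hα₄ hs₁ hs₂ hs₃ hs₄ hs₅ hs₆ hs₇ j hj z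

end Literature.MathematicalPhysics.QuantumFieldTheory.Balaban1983to89.B7Eq214GeneralQprime
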